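import Summits.CriticalPhenomena.PercolationContinuityZ3.Theorems.PercNearOneGluingNoHeavyLowerTailSahiGridPatternCoCountProductNCrossed

/-!
# `NoHeavyLowerTail` (crux stmt-CriticalPhenomena-4575), Sahi programme P1: **`GOOD × GOOD ⇒ GOOD` ON THE WHOLE CROSSED FAMILY** —
# the pattern functional of `(x∨y) × V` at every crossed test pair is an explicit NONNEGATIVE combination of two goodness slacks of `V`,
# two coefficientwise Harris slacks and one pair count (every `k`, no case hypothesis)

Support file (Sahi cell, seat `prim-sahi-p1`, generation 45; `--supports stmt-CriticalPhenomena-4575`).  Pure proofs, no definitions, no `sorry`,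
standard axioms.  Vocabulary of `…SahiGridPattern{,CellForm,RectCert,DiagCertBlockAndT,CoCountProductNProduct,CoCountProductNOrTwo,CoCountProductNCrossed}`
(`Pd`, `glue`, `ind`, `sStarD`, `thetaVal`, `lamU`, `nuCount`, `TotDist`, `thirdPt`).

THE MATHEMATICS (seat memo FROM-prim-sahi-p1-gen45, §1).  Outer block `S = {x≥1} ∨ {y≥1} ⊆ [3]²`, inner block `V ⊆ [3]^k`, `A = S × V ⊆ [3]^{2+k}`; outer
half-spaces `Fx = {x ≥ 1}`, `Gy = {y ≥ 1}`; inner sets `A₀, B′ ⊆ B ⊆ [3]^k`; the CROSSED test pair `P = Fx × A₀`, `Q = {(σ,q) : q ∈ B′} ∪ (Gy × B)` (its sections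
depend on DIFFERENT outer coordinates, so the pair is neither a product nor co-monotone).  Write, for inner sets `X, Y`,
`Φ_V(X,Y) := λ_V(X∩Y) − Θ_V(X×Y)` (`= sStarD V X Y`, the goodness slack of `V` at the rectangle `(X,Y)`), `n(X,Y) := #(X∩Y∩V)`,
`α(X,Y) := #{(q,r) ∈ X×Y : q δ̸ r, q ∈ V}`, `α′(X,Y) := #{(q,r) ∈ X×Y : q δ̸ r, r ∈ V}`.  THEN (pure bookkeeping, all finsets; `sStarD_blockAnd_orTwo_crossed_eq`):

  `sStarD (S×V) P Q = 12·Φ_V(A₀,B) + 8·Φ_V(A₀,B′) + 4·[2^k n(A₀,B) − α(A₀,B)] + 4·[2^k n(A₀,B) − α′(A₀,B)] + 4·α′(A₀,B′)`.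

The two square brackets are coefficientwise Harris slacks (`h_V(A₀,B)`, `h_V(B,A₀) ≥ 0` for up-sets, `pairCount_le_harris{,'}`) and `α′ ≥ 0` is a count.
**COROLLARY (`sStarD_blockAnd_orTwo_crossed_nonneg_of_sectionGood`, `sStarD_blockAnd_orTwo_crossed_good_nonneg`; every `k`, EVERY up-set `V`).**  If `V` is good at the two section rectangles
`(A₀,B)` and `(A₀,B′)` (in particular if `V` is good), then `0 ≤ sStarD ((x∨y)×V) P Q` at EVERY crossed pair — the statement "`V` good ⇒ `(x∨y) × V` good"
(`T×`, the weakest form of Conjecture A, memo gen43 §1.2) holds on the whole crossed family, with no hypothesis on the position of the `V`-layer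
`V ∩ (B ∖ B′)` (compare the four-case package `sStarD_blockAnd_orTwo_crossed_nonneg_of_good_layer` of generation 44, which it supersedes for this conclusion).
REMARK.  The stronger condition (N) for the co-count product `co(c, λ_V)` with the RECURSIVE outer certificate `c = (0|4,4|2,2|5555)` at crossed pairs is
`Δ_λ ≥ 0` (generations 42–44) and still carries the intrinsic term `−κ′_V(A₀,B′)`; the present identity is the one at the canonical outer certificate `λ_S`
(`λ_S = (−4|4,4|4,4|5555)` puts mass `4` instead of `2` on the cells `(1,0),(2,0)`), where that term is absent.  So the crossed-family difficulty of Conjecture A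
is a property of the recursive outer certificate, not of goodness of the product.  HONEST LABEL: `PatternPos d` (`d ≥ 4`), Conjecture A and `T×` in general remain
OPEN; nothing here asserts them. [this work]
-/

namespace Summit.CriticalPhenomena.PercolationContinuityZ3.Theorems.SahiGridPattern

open Finset SahiGrid3
open scoped BigOperators

section CrossedGood

variable {k : ℕ} {S Fx Gy : Finset (Pd (1 + 1))} {V : Finset (Pd k)} {A : Finset (Pd ((1 + 1) + k))}

/-- **The four outer cell sums of the crossed configuration against the canonical outer data**: `#(Fx∩S) = 6`, `#(Fx∩Gy∩S) = 4`,
`Σ_{ξ∈Fx} ν_S(ξ) = 20`, `Σ_{ξ∈Fx∩Gy} ν_S(ξ) = 12` (`ν_S(ξ) = #{η ∈ S : η δ̸ ξ}`). [this work] -/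
theorem outer_lamSums_crossed (hS : ∀ ξ η : Pd 1, glue ξ η ∈ S ↔ (1 ≤ ξ 0 ∨ 1 ≤ η 0))
    (hFx : ∀ ξ η : Pd 1, glue ξ η ∈ Fx ↔ 1 ≤ ξ 0) (hGy : ∀ ξ η : Pd 1, glue ξ η ∈ Gy ↔ 1 ≤ η 0) :
    (∑ ξ : Pd (1 + 1), ind Fx ξ * ind S ξ) = 6 ∧
    (∑ ξ : Pd (1 + 1), ind Fx ξ * ind Gy ξ * ind S ξ) = 4 ∧
    (∑ ξ : Pd (1 + 1), ind Fx ξ * (nuCount S ξ : ℤ)) = 20 ∧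
    (∑ ξ : Pd (1 + 1), ind Fx ξ * ind Gy ξ * (nuCount S ξ : ℤ)) = 12 := by
  obtain ⟨h00, h11, h22, h01, h02, h10, h12, h20, h21, t01, t02, t10, t12, t20, t21⟩ := pd1_facts
  obtain ⟨u00, u01, u02, u10, u11, u12, u20, u21, u22⟩ := ind_orTwo_vals hS
  obtain ⟨x00, x01, x02, x10, x11, x12, x20, x21, x22⟩ := ind_cellX_vals hFx
  obtain ⟨y00, y01, y02, y10, y11, y12, y20, y21, y22⟩ := ind_cellY_vals hGy
  refine ⟨?_, ?_, ?_, ?_⟩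
  · simp only [sum_glue (n := 1) (k := 1), sum_pd1,
      u00, u01, u02, u10, u11, u12, u20, u21, u22, x00, x01, x02, x10, x11, x12, x20, x21, x22,
      mul_zero, mul_one, zero_add, add_zero]
    norm_num
  · simp only [sum_glue (n := 1) (k := 1), sum_pd1,
      u00, u01, u02, u10, u11, u12, u20, u21, u22, x00, x01, x02, x10, x11, x12, x20, x21, x22,
      y00, y01, y02, y10, y11, y12, y20, y21, y22, mul_zero, mul_one, zero_add, add_zero]
    norm_num
  · simp only [nuCount_eq_sum_ind, sum_glue (n := 1) (k := 1), sum_pd1, ite_totDist_glue,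
      h00, h11, h22, h01, h02, h10, h12, h20, h21,
      u00, u01, u02, u10, u11, u12, u20, u21, u22, x00, x01, x02, x10, x11, x12, x20, x21, x22,
      Bool.false_eq_true, if_false, if_true, zero_mul, mul_zero, mul_one, one_mul, zero_add, add_zero]
    norm_num
  · simp only [nuCount_eq_sum_ind, sum_glue (n := 1) (k := 1), sum_pd1, ite_totDist_glue,
      h00, h11, h22, h01, h02, h10, h12, h20, h21,
      u00, u01, u02, u10, u11, u12, u20, u21, u22, x00, x01, x02, x10, x11, x12, x20, x21, x22,
      y00, y01, y02, y10, y11, y12, y20, y21, y22,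
      Bool.false_eq_true, if_false, if_true, zero_mul, mul_zero, mul_one, one_mul, zero_add, add_zero]
    norm_num

/-- **THEOREM (the pattern functional of `(x∨y) × V` at a crossed test pair, exactly; every `k`, all finsets).**
`S = {x≥1} ∨ {y≥1}` (`hS`), `A = S × V` (`hA`), `Fx = {x≥1}`, `Gy = {y≥1}` (`hFx`, `hGy`), inner sets `A₀, B′ ⊆ B` (`hsub`), `P = Fx × A₀` (`hP`),
`Q = {q ∈ B′} ∪ (Gy × B)` (`hQ`).  Then
`sStarD A P Q = 12·Φ_V(A₀,B) + 8·Φ_V(A₀,B′) + 4·[2^k n(A₀,B) − α(A₀,B)] + 4·[2^k n(A₀,B) − α′(A₀,B)] + 4·α′(A₀,B′)`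
with `Φ_V(X,Y) = Σ_{X∩Y} λ_V − Σ_{X×Y} Θ_V` and the pair counts written as indicator sums. [this work] -/
theorem sStarD_blockAnd_orTwo_crossed_eq (hS : ∀ ξ η : Pd 1, glue ξ η ∈ S ↔ (1 ≤ ξ 0 ∨ 1 ≤ η 0))
    (hFx : ∀ ξ η : Pd 1, glue ξ η ∈ Fx ↔ 1 ≤ ξ 0) (hGy : ∀ ξ η : Pd 1, glue ξ η ∈ Gy ↔ 1 ≤ η 0)
    (hA : ∀ σ z, glue σ z ∈ A ↔ (σ ∈ S ∧ z ∈ V))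
    {A0 Bp B0 : Finset (Pd k)} (hsub : Bp ⊆ B0)
    {P Q : Finset (Pd ((1 + 1) + k))} (hP : ∀ σ q, glue σ q ∈ P ↔ (σ ∈ Fx ∧ q ∈ A0)) (hQ : ∀ σ q, glue σ q ∈ Q ↔ (q ∈ Bp ∨ (σ ∈ Gy ∧ q ∈ B0))) :
    sStarD A P Q =
      12 * ((∑ q ∈ A0 ∩ B0, lamU V q) - ∑ q ∈ A0, ∑ r ∈ B0, thetaVal V q r)
      + 8 * ((∑ q ∈ A0 ∩ Bp, lamU V q) - ∑ q ∈ A0, ∑ r ∈ Bp, thetaVal V q r)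
      + 4 * ((2:ℤ) ^ k * (∑ q : Pd k, ind A0 q * ind B0 q * ind V q)
              - ∑ q : Pd k, ∑ r : Pd k, ind A0 q * ind B0 r * (if TotDist q r = true then (1:ℤ) else 0) * ind V q)
      + 4 * ((2:ℤ) ^ k * (∑ q : Pd k, ind A0 q * ind B0 q * ind V q)
              - ∑ q : Pd k, ∑ r : Pd k, ind A0 q * ind B0 r * (if TotDist q r = true then (1:ℤ) else 0) * ind V r)
      + 4 * (∑ q : Pd k, ∑ r : Pd k, ind A0 q * ind Bp r * (if TotDist q r = true then (1:ℤ) else 0) * ind V r) := by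
  obtain ⟨c24, c20, c20', c16, c16', c12⟩ := outer_pairCounts_crossed hS hFx hGy
  obtain ⟨e6, e4, e20, e12⟩ := outer_lamSums_crossed hS hFx hGy
  -- names for the inner counts
  set a : ℤ := ∑ q : Pd k, ∑ r : Pd k, ind A0 q * ind B0 r * (if TotDist q r = true then (1:ℤ) else 0) * ind V q with ha
  set a' : ℤ := ∑ q : Pd k, ∑ r : Pd k, ind A0 q * ind B0 r * (if TotDist q r = true then (1:ℤ) else 0) * ind V r with ha'
  set m : ℤ := ∑ q : Pd k, ∑ r : Pd k, ind A0 q * ind B0 r * (if TotDist q r = true then (1:ℤ) else 0) * ind V (thirdPt q r) with hm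
  set b : ℤ := ∑ q : Pd k, ∑ r : Pd k, ind A0 q * ind Bp r * (if TotDist q r = true then (1:ℤ) else 0) * ind V q with hb
  set b' : ℤ := ∑ q : Pd k, ∑ r : Pd k, ind A0 q * ind Bp r * (if TotDist q r = true then (1:ℤ) else 0) * ind V r with hb'
  set mb : ℤ := ∑ q : Pd k, ∑ r : Pd k, ind A0 q * ind Bp r * (if TotDist q r = true then (1:ℤ) else 0) * ind V (thirdPt q r) with hmb
  set nB : ℤ := ∑ q : Pd k, ind A0 q * ind B0 q * ind V q with hnB
  set vB : ℤ := ∑ q : Pd k, ind A0 q * ind B0 q * (nuCount V q : ℤ) with hvB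
  set nBp : ℤ := ∑ q : Pd k, ind A0 q * ind Bp q * ind V q with hnBp
  set vBp : ℤ := ∑ q : Pd k, ind A0 q * ind Bp q * (nuCount V q : ℤ) with hvBp
  -- outer counts as named sums
  set O1 : ℤ := ∑ ξ : Pd (1 + 1), ∑ η : Pd (1 + 1), ind Fx ξ * (if TotDist ξ η = true then (1:ℤ) else 0) * ind S ξ with hO1
  set O2 : ℤ := ∑ ξ : Pd (1 + 1), ∑ η : Pd (1 + 1), ind Fx ξ * (if TotDist ξ η = true then (1:ℤ) else 0) * ind S η with hO2
  set O3 : ℤ := ∑ ξ : Pd (1 + 1), ∑ η : Pd (1 + 1), ind Fx ξ * (if TotDist ξ η = true then (1:ℤ) else 0) * ind S (thirdPt ξ η) with hO3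
  set O1' : ℤ := ∑ ξ : Pd (1 + 1), ∑ η : Pd (1 + 1), ind Fx ξ * ind Gy η * (if TotDist ξ η = true then (1:ℤ) else 0) * ind S ξ with hO1'
  set O2' : ℤ := ∑ ξ : Pd (1 + 1), ∑ η : Pd (1 + 1), ind Fx ξ * ind Gy η * (if TotDist ξ η = true then (1:ℤ) else 0) * ind S η with hO2'
  set O3' : ℤ := ∑ ξ : Pd (1 + 1), ∑ η : Pd (1 + 1), ind Fx ξ * ind Gy η * (if TotDist ξ η = true then (1:ℤ) else 0) * ind S (thirdPt ξ η) with hO3'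
  set s1 : ℤ := ∑ ξ : Pd (1 + 1), ind Fx ξ * ind S ξ with hs1
  set s2 : ℤ := ∑ ξ : Pd (1 + 1), ind Fx ξ * ind Gy ξ * ind S ξ with hs2
  set t1 : ℤ := ∑ ξ : Pd (1 + 1), ind Fx ξ * (nuCount S ξ : ℤ) with ht1
  set t2 : ℤ := ∑ ξ : Pd (1 + 1), ind Fx ξ * ind Gy ξ * (nuCount S ξ : ℤ) with ht2
  -- (1) the Θ part
  have hL1 : (∑ x ∈ P, ∑ y ∈ Q, thetaVal A x y) =
      (O1 * b + O2 * b' - O3 * mb) + (O1' * a + O2' * a' - O3' * m) - (O1' * b + O2' * b' - O3' * mb) := by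
    rw [theta_pairs_eq_sum4 (n := 1 + 1) (k := k)]
    have hpt : ∀ (ξ : Pd (1 + 1)) (q : Pd k) (η : Pd (1 + 1)) (r : Pd k),
        ind P (glue ξ q) * ind Q (glue η r) * thetaVal A (glue ξ q) (glue η r) =
          ((ind Fx ξ * (if TotDist ξ η = true then (1:ℤ) else 0) * ind S ξ) * (ind A0 q * ind Bp r * (if TotDist q r = true then (1:ℤ) else 0) * ind V q)
           + (ind Fx ξ * (if TotDist ξ η = true then (1:ℤ) else 0) * ind S η) * (ind A0 q * ind Bp r * (if TotDist q r = true then (1:ℤ) else 0) * ind V r)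
           - (ind Fx ξ * (if TotDist ξ η = true then (1:ℤ) else 0) * ind S (thirdPt ξ η)) * (ind A0 q * ind Bp r * (if TotDist q r = true then (1:ℤ) else 0) * ind V (thirdPt q r)))
          + ((ind Fx ξ * ind Gy η * (if TotDist ξ η = true then (1:ℤ) else 0) * ind S ξ) * (ind A0 q * ind B0 r * (if TotDist q r = true then (1:ℤ) else 0) * ind V q)
           + (ind Fx ξ * ind Gy η * (if TotDist ξ η = true then (1:ℤ) else 0) * ind S η) * (ind A0 q * ind B0 r * (if TotDist q r = true then (1:ℤ) else 0) * ind V r)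
           - (ind Fx ξ * ind Gy η * (if TotDist ξ η = true then (1:ℤ) else 0) * ind S (thirdPt ξ η)) * (ind A0 q * ind B0 r * (if TotDist q r = true then (1:ℤ) else 0) * ind V (thirdPt q r)))
          - ((ind Fx ξ * ind Gy η * (if TotDist ξ η = true then (1:ℤ) else 0) * ind S ξ) * (ind A0 q * ind Bp r * (if TotDist q r = true then (1:ℤ) else 0) * ind V q)
           + (ind Fx ξ * ind Gy η * (if TotDist ξ η = true then (1:ℤ) else 0) * ind S η) * (ind A0 q * ind Bp r * (if TotDist q r = true then (1:ℤ) else 0) * ind V r)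
           - (ind Fx ξ * ind Gy η * (if TotDist ξ η = true then (1:ℤ) else 0) * ind S (thirdPt ξ η)) * (ind A0 q * ind Bp r * (if TotDist q r = true then (1:ℤ) else 0) * ind V (thirdPt q r))) := by
      intro ξ q η r
      rw [thetaVal_eq_ite_mul, ite_totDist_glue, thirdPt_glue, ind_glue_product hA, ind_glue_product hA, ind_glue_product hA,
        ind_glue_product hP, ind_glue_crossedQ hQ hsub]
      ring
    rw [Finset.sum_congr rfl fun ξ _ => Finset.sum_congr rfl fun q _ => Finset.sum_congr rfl fun η _ =>
      Finset.sum_congr rfl fun r _ => hpt ξ q η r]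
    simp only [Finset.sum_sub_distrib, Finset.sum_add_distrib]
    rw [sum4_mul_eq, sum4_mul_eq, sum4_mul_eq, sum4_mul_eq, sum4_mul_eq, sum4_mul_eq, sum4_mul_eq, sum4_mul_eq, sum4_mul_eq]
  -- (2) the λ part, by the three product pieces of `1_P·1_Q`
  set G1 : Pd (1 + 1) → Pd k → ℤ := fun ξ q => 2 * (2:ℤ) ^ ((1 + 1) + k) * ((ind Fx ξ * ind S ξ) * (ind A0 q * ind Bp q * ind V q))
      - (ind Fx ξ * (nuCount S ξ : ℤ)) * (ind A0 q * ind Bp q * (nuCount V q : ℤ)) with hG1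
  set G2 : Pd (1 + 1) → Pd k → ℤ := fun ξ q => 2 * (2:ℤ) ^ ((1 + 1) + k) * ((ind Fx ξ * ind Gy ξ * ind S ξ) * (ind A0 q * ind B0 q * ind V q))
      - (ind Fx ξ * ind Gy ξ * (nuCount S ξ : ℤ)) * (ind A0 q * ind B0 q * (nuCount V q : ℤ)) with hG2
  set G3 : Pd (1 + 1) → Pd k → ℤ := fun ξ q => 2 * (2:ℤ) ^ ((1 + 1) + k) * ((ind Fx ξ * ind Gy ξ * ind S ξ) * (ind A0 q * ind Bp q * ind V q))
      - (ind Fx ξ * ind Gy ξ * (nuCount S ξ : ℤ)) * (ind A0 q * ind Bp q * (nuCount V q : ℤ)) with hG3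
  have hg1 : (∑ ξ : Pd (1 + 1), ∑ q : Pd k, G1 ξ q) = 2 * (2:ℤ) ^ ((1 + 1) + k) * (s1 * nBp) - t1 * vBp := by
    rw [hG1, sum2_linComb]
  have hg2 : (∑ ξ : Pd (1 + 1), ∑ q : Pd k, G2 ξ q) = 2 * (2:ℤ) ^ ((1 + 1) + k) * (s2 * nB) - t2 * vB := by
    rw [hG2, sum2_linComb]
  have hg3 : (∑ ξ : Pd (1 + 1), ∑ q : Pd k, G3 ξ q) = 2 * (2:ℤ) ^ ((1 + 1) + k) * (s2 * nBp) - t2 * vBp := by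
    rw [hG3, sum2_linComb]
  have hR1 : (∑ x ∈ P ∩ Q, lamU A x) =
      (2 * (2:ℤ) ^ ((1 + 1) + k) * (s1 * nBp) - t1 * vBp) + (2 * (2:ℤ) ^ ((1 + 1) + k) * (s2 * nB) - t2 * vB)
      - (2 * (2:ℤ) ^ ((1 + 1) + k) * (s2 * nBp) - t2 * vBp) := by
    rw [sum_mem_eq_sum_ind_mul (P ∩ Q), sum_glue (n := 1 + 1) (k := k)]
    have hpt : ∀ (ξ : Pd (1 + 1)) (q : Pd k), ind (P ∩ Q) (glue ξ q) * lamU A (glue ξ q) = G1 ξ q + G2 ξ q - G3 ξ q := by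
      intro ξ q
      rw [hG1, hG2, hG3, ind_inter_eq_mul, ind_glue_product hP, ind_glue_crossedQ hQ hsub, lamU_blockAnd hA]
      ring
    rw [Finset.sum_congr rfl fun ξ _ => Finset.sum_congr rfl fun q _ => hpt ξ q]
    simp only [Finset.sum_sub_distrib, Finset.sum_add_distrib]
    rw [hg1, hg2, hg3]
  -- (3) the two goodness slacks in counts
  have hLB : (∑ q ∈ A0 ∩ B0, lamU V q) = 2 * (2:ℤ) ^ k * nB - vB := by
    rw [sum_mem_eq_sum_ind_mul (A0 ∩ B0), hnB, hvB, Finset.mul_sum, ← Finset.sum_sub_distrib]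
    refine Finset.sum_congr rfl fun q _ => ?_
    rw [ind_inter_eq_mul]
    unfold lamU
    ring
  have hLBp : (∑ q ∈ A0 ∩ Bp, lamU V q) = 2 * (2:ℤ) ^ k * nBp - vBp := by
    rw [sum_mem_eq_sum_ind_mul (A0 ∩ Bp), hnBp, hvBp, Finset.mul_sum, ← Finset.sum_sub_distrib]
    refine Finset.sum_congr rfl fun q _ => ?_
    rw [ind_inter_eq_mul]
    unfold lamU
    ring
  have hΘB : (∑ q ∈ A0, ∑ r ∈ B0, thetaVal V q r) = a + a' - m := theta_rect_eq_counts V A0 B0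
  have hΘBp : (∑ q ∈ A0, ∑ r ∈ Bp, thetaVal V q r) = b + b' - mb := theta_rect_eq_counts V A0 Bp
  -- (4) conclusion
  rw [sStarD_eq_sum_lamU_sub_sum_thetaVal, hL1, hR1, hLB, hLBp, hΘB, hΘBp, c24, c20, c20', c16, c16', c12, e6, e4, e20, e12, pow_add]
  have h4 : (2:ℤ) ^ (1 + 1) = 4 := by norm_num
  rw [h4]
  ring

/-- **COROLLARY (`T×` on the crossed family from goodness at the two section rectangles; every `k`).**  For up-sets `V, A₀, B` (and any `B′ ⊆ B`) with `V` good at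
`(A₀,B)` (`hGB`) and at `(A₀,B′)` (`hGBp`): `0 ≤ sStarD ((x∨y)×V) P Q` at the crossed pair.  The up-set hypotheses enter only through the two coefficientwise
Harris slacks. [this work] -/
theorem sStarD_blockAnd_orTwo_crossed_nonneg_of_sectionGood (hS : ∀ ξ η : Pd 1, glue ξ η ∈ S ↔ (1 ≤ ξ 0 ∨ 1 ≤ η 0))
    (hFx : ∀ ξ η : Pd 1, glue ξ η ∈ Fx ↔ 1 ≤ ξ 0) (hGy : ∀ ξ η : Pd 1, glue ξ η ∈ Gy ↔ 1 ≤ η 0)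
    (hV : IsUpperSet (V : Set (Pd k))) (hA : ∀ σ z, glue σ z ∈ A ↔ (σ ∈ S ∧ z ∈ V))
    {A0 Bp B0 : Finset (Pd k)} (hA0 : IsUpperSet (A0 : Set (Pd k))) (hB0 : IsUpperSet (B0 : Set (Pd k))) (hsub : Bp ⊆ B0)
    (hGB : (∑ q ∈ A0, ∑ r ∈ B0, thetaVal V q r) ≤ ∑ q ∈ A0 ∩ B0, lamU V q)
    (hGBp : (∑ q ∈ A0, ∑ r ∈ Bp, thetaVal V q r) ≤ ∑ q ∈ A0 ∩ Bp, lamU V q)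
    {P Q : Finset (Pd ((1 + 1) + k))} (hP : ∀ σ q, glue σ q ∈ P ↔ (σ ∈ Fx ∧ q ∈ A0)) (hQ : ∀ σ q, glue σ q ∈ Q ↔ (q ∈ Bp ∨ (σ ∈ Gy ∧ q ∈ B0))) :
    0 ≤ sStarD A P Q := by
  rw [sStarD_blockAnd_orTwo_crossed_eq hS hFx hGy hA hsub hP hQ]
  have h1 : (∑ q : Pd k, ∑ r : Pd k, ind A0 q * ind B0 r * (if TotDist q r = true then (1:ℤ) else 0) * ind V q)
      ≤ 2 ^ k * ∑ q : Pd k, ind A0 q * ind B0 q * ind V q := pairCount_le_harris hV hA0 hB0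
  have h2 : (∑ q : Pd k, ∑ r : Pd k, ind A0 q * ind B0 r * (if TotDist q r = true then (1:ℤ) else 0) * ind V r)
      ≤ 2 ^ k * ∑ q : Pd k, ind A0 q * ind B0 q * ind V q := pairCount_le_harris' hV hA0 hB0
  have h3 : 0 ≤ ∑ q : Pd k, ∑ r : Pd k, ind A0 q * ind Bp r * (if TotDist q r = true then (1:ℤ) else 0) * ind V r :=
    Finset.sum_nonneg fun q _ => Finset.sum_nonneg fun r _ =>
      mul_nonneg (mul_nonneg (mul_nonneg (ind_nonneg' A0 q) (ind_nonneg' Bp r)) (by split_ifs <;> norm_num)) (ind_nonneg' V r)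
  linarith

/-- **COROLLARY (`good × good ⇒ good` on the WHOLE crossed family; every `k`, every up-set `V`).**  If the up-set `V ⊆ [3]^k` is good (`hGV`: `sStarD V X X' ≥ 0` in
its bilinear form at every pair of up-sets), then for ALL up-sets `A₀, B′ ⊆ B` the block product `(x∨y) × V` is nonnegative for the pattern functional at the crossed
pair `P = {x≥1} × A₀`, `Q = {q ∈ B′} ∪ ({y≥1} × B)` — no hypothesis on the `V`-layer `V ∩ (B ∖ B′)`, no certificate. [this work] -/
theorem sStarD_blockAnd_orTwo_crossed_good_nonneg (hS : ∀ ξ η : Pd 1, glue ξ η ∈ S ↔ (1 ≤ ξ 0 ∨ 1 ≤ η 0))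
    (hFx : ∀ ξ η : Pd 1, glue ξ η ∈ Fx ↔ 1 ≤ ξ 0) (hGy : ∀ ξ η : Pd 1, glue ξ η ∈ Gy ↔ 1 ≤ η 0)
    (hV : IsUpperSet (V : Set (Pd k))) (hA : ∀ σ z, glue σ z ∈ A ↔ (σ ∈ S ∧ z ∈ V))
    (hGV : ∀ X X' : Finset (Pd k), IsUpperSet (X : Set (Pd k)) → IsUpperSet (X' : Set (Pd k)) →
      (∑ q ∈ X, ∑ r ∈ X', thetaVal V q r) ≤ ∑ q ∈ X ∩ X', lamU V q)
    {A0 Bp B0 : Finset (Pd k)} (hA0 : IsUpperSet (A0 : Set (Pd k))) (hBp : IsUpperSet (Bp : Set (Pd k))) (hB0 : IsUpperSet (B0 : Set (Pd k)))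
    (hsub : Bp ⊆ B0)
    {P Q : Finset (Pd ((1 + 1) + k))} (hP : ∀ σ q, glue σ q ∈ P ↔ (σ ∈ Fx ∧ q ∈ A0)) (hQ : ∀ σ q, glue σ q ∈ Q ↔ (q ∈ Bp ∨ (σ ∈ Gy ∧ q ∈ B0))) :
    0 ≤ sStarD A P Q :=
  sStarD_blockAnd_orTwo_crossed_nonneg_of_sectionGood hS hFx hGy hV hA hA0 hB0 hsub (hGV A0 B0 hA0 hB0) (hGV A0 Bp hA0 hBp) hP hQ

end CrossedGood

end Summit.CriticalPhenomena.PercolationContinuityZ3.Theorems.SahiGridPattern
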